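import Mathlib
import Summits.MatrixMultiplication.MatrixMultiplication.Theorems.FidelityWitnessesFidelityGapThreeSeventeenStubBorelNormalFormOps
import Summits.MatrixMultiplication.MatrixMultiplication.Theorems.FidelityWitnessesFidelityGapThreeSeventeenStubBorelNormalFormTorus

/-!
# Borel normal form, part 9: torus data of the diagonal operators

Support file for `stub_borelNormalForm` (line `symbolic-square-border-apolarity` of
`FidelityWitnesses.FidelityGapThreeSeventeen`).  For the diagonal operator `E_{pp}` of factor `X`
(`opL X p p`): its torus weights `nT X p v = 1 + up(v) - down(v) ∈ {0,1,2}` and the complement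
`nT' = 2 - nT`; the EIGENVALUE formula `E_{pp} x^d = (#up(d) - #down(d)) x^d`, whence `E_{pp}` acts by the
scalar `j - |m|` on the `nT`-weight-`j` slice of `S m` (`opL_self_whc`); every operator `opL Y p' q'`
shifts `nT'` by a constant along its moves (`opL_shift`: the torus normalises the Borel subalgebra); and
the weights are constant (`= 3`) on the support of `T3`.  PROVED.
-/

noncomputable section

namespace Summit.MatrixMultiplication.MatrixMultiplication.Theorems.SymbolicSquare

-- single-conjunct summit: the `Summit.<S>.<P>` prefix repeats `MatrixMultiplication` by design (D-0017)
set_option linter.dupNamespace false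

open scoped BigOperators Polynomial
open Polynomial

/-! ## Torus data: weights of the diagonal operators, eigenvalues on weight slices, shifts -/

section TorusData

open BorelLimit

/-- Indicator of the variables of slot `s` with FIRST index `p`. -/
def rowInd (s p : Fin 3) (v : Var) : ℕ := if v.1 = s ∧ v.2.1 = p then 1 else 0

/-- Indicator of the variables of slot `s` with SECOND index `p`. -/
def colInd (s p : Fin 3) (v : Var) : ℕ := if v.1 = s ∧ v.2.2 = p then 1 else 0

/-- `weight` is additive in the weight function. -/
theorem weight_add_fun (f g : Var → ℕ) (d : Var →₀ ℕ) :
    Finsupp.weight (fun v => f v + g v) d = Finsupp.weight f d + Finsupp.weight g d := by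
  simp only [Finsupp.weight_apply, smul_eq_mul, mul_add, Finsupp.sum_add]

/-- The `rowInd`-weight of an exponent: `∑_j d (s,(p,j))`. -/
theorem weight_rowInd (s p : Fin 3) (d : Var →₀ ℕ) : Finsupp.weight (rowInd s p) d = ∑ j : Fin 3, d (s, (p, j)) := by
  rw [Finsupp.weight_apply, Finsupp.sum_fintype _ _ (fun v => by simp)]
  simp only [smul_eq_mul, rowInd, mul_ite, mul_one, mul_zero]
  rw [Fintype.sum_prod_type, Finset.sum_eq_single s]
  · rw [Fintype.sum_prod_type, Finset.sum_eq_single p]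
    · exact Finset.sum_congr rfl fun j _ => by simp
    · intro i _ hi
      exact Finset.sum_eq_zero fun j _ => by simp [hi]
    · intro h; exact absurd (Finset.mem_univ p) h
  · intro s' _ hs'
    rw [Fintype.sum_prod_type]
    exact Finset.sum_eq_zero fun i _ => Finset.sum_eq_zero fun j _ => by simp [hs']
  · intro h; exact absurd (Finset.mem_univ s) h

/-- The `colInd`-weight of an exponent: `∑_i d (s,(i,p))`. -/
theorem weight_colInd (s p : Fin 3) (d : Var →₀ ℕ) : Finsupp.weight (colInd s p) d = ∑ i : Fin 3, d (s, (i, p)) := by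
  rw [Finsupp.weight_apply, Finsupp.sum_fintype _ _ (fun v => by simp)]
  simp only [smul_eq_mul, colInd, mul_ite, mul_one, mul_zero]
  rw [Fintype.sum_prod_type, Finset.sum_eq_single s]
  · rw [Fintype.sum_prod_type]
    refine Finset.sum_congr rfl fun i _ => ?_
    rw [Finset.sum_eq_single p]
    · simp
    · intro j _ hj; simp [hj]
    · intro h; exact absurd (Finset.mem_univ p) h
  · intro s' _ hs'
    rw [Fintype.sum_prod_type]
    exact Finset.sum_eq_zero fun i _ => Finset.sum_eq_zero fun j _ => by simp [hs']
  · intro h; exact absurd (Finset.mem_univ s) h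

/-- Diagonal row operation: `R_{pp} x^d = (∑_j d_{(s,(p,j))}) x^d`. -/
theorem rowOp_self_monomial (s p : Fin 3) (d : Var →₀ ℕ) (r : ℂ) :
    rowOp s p p (MvPolynomial.monomial d r) = (Finsupp.weight (rowInd s p) d : ℂ) • MvPolynomial.monomial d r := by
  rw [rowOp, lvf_apply, weight_rowInd, Nat.cast_sum, Finset.sum_smul]
  refine Finset.sum_congr rfl fun j _ => ?_
  rw [one_smul, xd_self_monomial]

/-- Diagonal column operation: `C_{pp} x^d = (∑_i d_{(s,(i,p))}) x^d`. -/
theorem colOp_self_monomial (s p : Fin 3) (d : Var →₀ ℕ) (r : ℂ) :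
    colOp s p p (MvPolynomial.monomial d r) = (Finsupp.weight (colInd s p) d : ℂ) • MvPolynomial.monomial d r := by
  rw [colOp, lvf_apply, weight_colInd, Nat.cast_sum, Finset.sum_smul]
  refine Finset.sum_congr rfl fun i _ => ?_
  rw [one_smul, xd_self_monomial]

/-- The variables RAISED by the diagonal operator `E_{pp}` of factor `X`. -/
def upI (X p : Fin 3) : Var → ℕ := ![rowInd 0 p, rowInd 1 p, colInd 2 p] X

/-- The variables LOWERED by the diagonal operator `E_{pp}` of factor `X`. -/
def dnI (X p : Fin 3) : Var → ℕ := ![rowInd 2 p, colInd 0 p, colInd 1 p] X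

/-- **Eigenvalues**: `E_{pp}` of factor `X` acts on `x^d` by `#up(d) - #down(d)`. -/
theorem opL_self_monomial (X p : Fin 3) (d : Var →₀ ℕ) (r : ℂ) :
    opL X p p (MvPolynomial.monomial d r) =
      ((Finsupp.weight (upI X p) d : ℂ) - (Finsupp.weight (dnI X p) d : ℂ)) • MvPolynomial.monomial d r := by
  have hX : X = 0 ∨ X = 1 ∨ X = 2 := by fin_cases X <;> simp
  rcases hX with rfl | rfl | rfl
  · rw [opL0_eq, LinearMap.sub_apply, rowOp_self_monomial, rowOp_self_monomial, ← sub_smul]; rfl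
  · rw [opL1_eq, LinearMap.add_apply, LinearMap.neg_apply, colOp_self_monomial, rowOp_self_monomial, ← neg_smul,
      ← add_smul, neg_add_eq_sub]; rfl
  · rw [opL2_eq, LinearMap.add_apply, LinearMap.neg_apply, colOp_self_monomial, colOp_self_monomial, ← neg_smul,
      ← add_smul, neg_add_eq_sub]; rfl

/-- The TORUS WEIGHTS of the diagonal operator `E_{pp}` of factor `X`: `1 + up - down ∈ {0,1,2}`. -/
def nT (X p : Fin 3) (v : Var) : ℕ := 1 + upI X p v - dnI X p v

/-- The complementary torus weights `2 - nT`. -/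
def nT' (X p : Fin 3) (v : Var) : ℕ := 1 + dnI X p v - upI X p v

/-- `rowInd ≤ 1`. -/
theorem rowInd_le (s p : Fin 3) (v : Var) : rowInd s p v ≤ 1 := by
  simp only [rowInd]; split_ifs <;> simp

/-- `colInd ≤ 1`. -/
theorem colInd_le (s p : Fin 3) (v : Var) : colInd s p v ≤ 1 := by
  simp only [colInd]; split_ifs <;> simp

/-- `up ≤ 1`. -/
theorem upI_le (X p : Fin 3) (v : Var) : upI X p v ≤ 1 := by
  have hX : X = 0 ∨ X = 1 ∨ X = 2 := by fin_cases X <;> simp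
  rcases hX with rfl | rfl | rfl
  · exact rowInd_le 0 p v
  · exact rowInd_le 1 p v
  · exact colInd_le 2 p v

/-- `down ≤ 1`. -/
theorem dnI_le (X p : Fin 3) (v : Var) : dnI X p v ≤ 1 := by
  have hX : X = 0 ∨ X = 1 ∨ X = 2 := by fin_cases X <;> simp
  rcases hX with rfl | rfl | rfl
  · exact rowInd_le 2 p v
  · exact colInd_le 0 p v
  · exact colInd_le 1 p v

/-- `up` and `down` are disjoint. -/
theorem upI_add_dnI_le (X p : Fin 3) (v : Var) : upI X p v + dnI X p v ≤ 1 := by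
  have hX : X = 0 ∨ X = 1 ∨ X = 2 := by fin_cases X <;> simp
  rcases hX with rfl | rfl | rfl
  · change rowInd 0 p v + rowInd 2 p v ≤ 1
    simp only [rowInd]; split_ifs <;> simp_all
  · change rowInd 1 p v + colInd 0 p v ≤ 1
    simp only [rowInd, colInd]; split_ifs <;> simp_all
  · change colInd 2 p v + colInd 1 p v ≤ 1
    simp only [colInd]; split_ifs <;> simp_all

/-- The two torus weight functions are complementary: `nT + nT' = 2`. -/
theorem nT_add_nT' (X p : Fin 3) (v : Var) : nT X p v + nT' X p v = 2 := by
  have h1 := upI_le X p v; have h2 := dnI_le X p v; have h3 := upI_add_dnI_le X p v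
  simp only [nT, nT']
  omega

/-- `nT + down = 1 + up` pointwise. -/
theorem nT_add_dnI (X p : Fin 3) (v : Var) : nT X p v + dnI X p v = 1 + upI X p v := by
  have h1 := upI_le X p v; have h2 := dnI_le X p v; have h3 := upI_add_dnI_le X p v
  simp only [nT]
  omega

/-- **Weights and eigenvalues**: `nT·d + #down(d) = deg d + #up(d)`. -/
theorem weight_nT_add (X p : Fin 3) (d : Var →₀ ℕ) :
    Finsupp.weight (nT X p) d + Finsupp.weight (dnI X p) d = Finsupp.degree d + Finsupp.weight (upI X p) d := by
  rw [← weight_add_fun, Finsupp.degree_eq_weight_one, ← weight_add_fun]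
  have h : (fun v => nT X p v + dnI X p v) = (fun v => 1 + upI X p v) := funext (nT_add_dnI X p)
  rw [h]

/-- **The diagonal operator is a scalar on each torus weight slice of `S m`**:
`E_{pp} · f_{nT = j} = (j - |m|) f_{nT = j}` for `f ∈ S m`. -/
theorem opL_self_whc (X p : Fin 3) (m : MDeg) (j : ℕ) {f : Poly} (hf : f ∈ S m) :
    opL X p p (MvPolynomial.weightedHomogeneousComponent (nT X p) j f) =
      ((j : ℂ) - ((m 0 + m 1 + m 2 : ℕ) : ℂ)) • MvPolynomial.weightedHomogeneousComponent (nT X p) j f := by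
  classical
  set g := MvPolynomial.weightedHomogeneousComponent (nT X p) j f with hg
  have hgS : g ∈ S m := whc_mem_weightedHomogeneousSubmodule (nT X p) wt m j hf
  have hdeg := S_le_restrictSupport_degree m hgS
  rw [MvPolynomial.mem_restrictSupport_iff] at hdeg
  have hwt := MvPolynomial.weightedHomogeneousComponent_isWeightedHomogeneous (w := nT X p) j f
  conv_lhs => rw [← g.support_sum_monomial_coeff]
  conv_rhs => rw [← g.support_sum_monomial_coeff]
  rw [map_sum, Finset.smul_sum]
  refine Finset.sum_congr rfl fun d hd => ?_
  rw [opL_self_monomial]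
  congr 1
  have h1 : Finsupp.degree d = m 0 + m 1 + m 2 := hdeg hd
  have h2 : Finsupp.weight (nT X p) d = j := hwt (MvPolynomial.mem_support_iff.1 hd)
  have h3 := weight_nT_add X p d
  rw [h1, h2] at h3
  have h4 : ((j : ℕ) : ℂ) + (Finsupp.weight (dnI X p) d : ℂ) =
      ((m 0 + m 1 + m 2 : ℕ) : ℂ) + (Finsupp.weight (upI X p) d : ℂ) := by exact_mod_cast h3
  linear_combination -h4

/-- **Shifts**: every operator `opL Y p' q'` shifts the complementary torus weight `nT' X p` by a constant
along its moves (so the torus normalises it). -/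
theorem opL_shift (X p Y p' q' : Fin 3) : ∃ s₁ s₂ : ℕ, ∀ i : Fin 3 ⊕ Fin 3,
    nT' X p (opb Y p' q' i) + s₁ = nT' X p (opa Y p' q' i) + s₂ := by
  refine ⟨nT' X p (opa Y p' q' (Sum.inl 0)), nT' X p (opb Y p' q' (Sum.inl 0)), fun i => ?_⟩
  have hX : X = 0 ∨ X = 1 ∨ X = 2 := by fin_cases X <;> simp
  have hY : Y = 0 ∨ Y = 1 ∨ Y = 2 := by fin_cases Y <;> simp
  rcases hX with rfl | rfl | rfl <;> rcases hY with rfl | rfl | rfl <;> rcases i with j | k <;>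
    simp [nT', upI, dnI, rowInd, colInd, opa, opb] <;> split_ifs <;> omega

/-- Weight of a multilinear exponent. -/
theorem weight_ms (w : Var → ℕ) (a b c : P3) : Finsupp.weight w (ms a b c) = w (2, a) + w (0, b) + w (1, c) := by
  simp only [ms, map_add, Finsupp.weight_single, smul_eq_mul, one_mul]

/-- The torus weights are constant (`= 3`) on the support of `T3`. -/
theorem weight_nT_ms (X p i j k : Fin 3) : Finsupp.weight (nT X p) (ms (i, k) (i, j) (j, k)) = 3 := by
  have hX : X = 0 ∨ X = 1 ∨ X = 2 := by fin_cases X <;> simp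
  rw [weight_ms]
  rcases hX with rfl | rfl | rfl <;> simp [nT, upI, dnI, rowInd, colInd] <;> split_ifs <;> omega

/-- The complementary torus weights are constant (`= 3`) on the support of `T3`. -/
theorem weight_nT'_ms (X p i j k : Fin 3) : Finsupp.weight (nT' X p) (ms (i, k) (i, j) (j, k)) = 3 := by
  have hX : X = 0 ∨ X = 1 ∨ X = 2 := by fin_cases X <;> simp
  rw [weight_ms]
  rcases hX with rfl | rfl | rfl <;> simp [nT', upI, dnI, rowInd, colInd] <;> split_ifs <;> omega

end TorusData


/-- **Part 9 of `stub_borelNormalForm` (registered helper stub): the torus normalises the Borel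
subalgebra** — every operator shifts the complementary torus weight by a constant along its moves. -/
theorem stub_borelNormalForm_torusdata : ∀ (X p Y p' q' : Fin 3), ∃ s₁ s₂ : ℕ, ∀ i : Fin 3 ⊕ Fin 3,
    nT' X p (opb Y p' q' i) + s₁ = nT' X p (opa Y p' q' i) + s₂ :=
  fun X p Y p' q' => opL_shift X p Y p' q'

end Summit.MatrixMultiplication.MatrixMultiplication.Theorems.SymbolicSquare

end
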